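import Literature.NumberTheory.ComplexMultiplication.EllipticUnits.ImaginaryQuadraticMainConjectureTorsionCoefficients
import Literature.NumberTheory.GaloisRepresentations.ContinuousShapiroLiftPairing
import Literature.NumberTheory.GaloisRepresentations.ContinuousShapiroOpenCoinducedRightAction
import HarnessLib

/-!
# The three ADJOINT PAIRS for the summed pairings of coinduced modules: trace ⊣ pull-back, right translation
# `R_c ⊣ R_{c⁻¹}`, and the level change `ζ ↦ ζ^p ⊣ a ↦ p·a` — the hypotheses `hadj` of clause (N_V) of the layer
# Poitou–Tate fact (Milne I §4 p. 65: naturality of the pairing)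

Topic `Literature/NumberTheory/ComplexMultiplication/EllipticUnits` (grouping sub-namespace `JohnsonLeungKings2011.ClassGroupRow`).
Cell `bsd-print-cf2`, width seat `bsd-line-cf2c-w8` g8: the finite-sum identities that feed clause (N_V) of
`PoitouTateShaRestrictedLayers.exists_shaRestricted_pairing_coind_of_natural_at` (seat cf2c-w8 g7) for the three structure maps of
the ROW 1 socket (`pair_cores`, `pair_conj`, `pair_red` of `JohnsonLeungKings2011.LayerDuality`). THEOREMS ONLY; no definition, no
named fact, no instance, no `sorry`.

* `sum_pairing_coindFinRes_eq_sum_coindFinSum` — `Σ_{z ∈ G/N′} B(φ z, ψ(π z)) = Σ_{y ∈ G/N} B((Σ-fibre φ) y, ψ y)` (trace ⊣ pull-back);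
* `sum_pairing_rTrans` — `Σ_y B(φ(y c), ψ y) = Σ_y B(φ y, ψ(y c⁻¹))` (`R_c ⊣ R_{c⁻¹}`);
* `muVal_sum` and `muVal_sum_muZModPairing_muPowMap` — `∏_y B_k(ζ_y^p, a_y) = ∏_y B_{k+1}(ζ_y, p·a_y)` in `K̄ˣ` (reduction ⊣ inclusion,
  termwise `muZModPairing_muPowMap`).

HONEST FRAMING: finite-sum bookkeeping; no duality, no main conjecture, no BSD is proved here; no summit statement is proved by this seat.

## References
* J. S. Milne, *Arithmetic Duality Theorems* (2006), I §4 p. 65 (naturality of the Poitou–Tate pairing), I §0. [MilneADT2006]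
* J. Neukirch, A. Schmidt, K. Wingberg (2008), I §5 Prop. (1.5.3)(iv), I §6 (1.6.4). [NeukirchSchmidtWingberg2008]
* J.-P. Serre, *Local Fields* (1979), VII §5. [SerreLocalFields1979]
-/

noncomputable section

open scoped NumberField
open Field
open Literature.NumberTheory.GaloisRepresentations
open Literature.NumberTheory.GaloisRepresentations.DiscreteGaloisModule

namespace Literature.NumberTheory.ComplexMultiplication.EllipticUnits.JohnsonLeungKings2011.ClassGroupRow

/-! ## §1 Trace ⊣ pull-back -/

section Trace

variable {G : Type*} [Group G] {N N' : Subgroup G} (h : N' ≤ N) [Fintype (G ⧸ N)] [Fintype (G ⧸ N')]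
  {M M' A : Type*} [AddCommGroup M] [AddCommGroup M'] [AddCommMonoid A] (B : M →+ M' →+ A)

/-- **Trace is adjoint to pull-back for the summed pairing**: for `φ : G ⧸ N′ → M`, `ψ : G ⧸ N → M′`,
`Σ_{z} B(φ z, ψ(π z)) = Σ_{y} B((Σ_{π z = y} φ z), ψ y)` (`π : G ⧸ N′ → G ⧸ N`; the fibre sum is the tree's `coindFinSum`, the
pull-back its `coindFinRes`). [cite: MilneADT2006, I §4 p. 65] [cite: NeukirchSchmidtWingberg2008, I §5 Prop. (1.5.3)(iv)] -/
theorem sum_pairing_coindFinRes_eq_sum_coindFinSum [DecidableEq (G ⧸ N)] (φ : G ⧸ N' → M) (ψ : G ⧸ N → M') :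
    ∑ z : G ⧸ N', B (φ z) (ψ (Subgroup.quotientMapOfLE h z)) =
      ∑ y : G ⧸ N, B (∑ z : G ⧸ N', if Subgroup.quotientMapOfLE h z = y then φ z else 0) (ψ y) := by
  have hstep : ∀ y : G ⧸ N, B (∑ z : G ⧸ N', if Subgroup.quotientMapOfLE h z = y then φ z else 0) (ψ y) =
      ∑ z : G ⧸ N', if Subgroup.quotientMapOfLE h z = y then B (φ z) (ψ y) else 0 := fun y => by
    rw [map_sum, AddMonoidHom.finsetSum_apply]
    refine Finset.sum_congr rfl fun z _ => ?_
    split_ifs with hz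
    · rfl
    · rw [map_zero, AddMonoidHom.zero_apply]
  simp_rw [hstep]
  rw [Finset.sum_comm]
  refine Finset.sum_congr rfl fun z _ => ?_
  rw [Finset.sum_ite_eq, if_pos (Finset.mem_univ _)]

end Trace

/-! ## §2 Right translation -/

section RTrans

variable {G : Type*} [Group G] {N : Subgroup G} [N.Normal] [Fintype (G ⧸ N)]
  {M M' A : Type*} [AddCommGroup M] [AddCommGroup M'] [AddCommMonoid A] (B : M →+ M' →+ A)

/-- **`R_c` is adjoint to `R_{c⁻¹}` for the summed pairing**: `Σ_y B(φ(y c), ψ y) = Σ_y B(φ y, ψ(y c⁻¹))` (reindex by `y ↦ y c`;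
the tree's `coindOpenRTrans`, `(R_c φ)(y) = φ(y c)`). [cite: SerreLocalFields1979, VII §5] [cite: MilneADT2006, I §4 p. 65] -/
theorem sum_pairing_rTrans (c : G ⧸ N) (φ : G ⧸ N → M) (ψ : G ⧸ N → M') :
    ∑ y : G ⧸ N, B (φ (y * c)) (ψ y) = ∑ y : G ⧸ N, B (φ y) (ψ (y * c⁻¹)) := by
  refine Fintype.sum_equiv (Equiv.mulRight c) _ _ fun y => ?_
  rw [Equiv.coe_mulRight, mul_inv_cancel_right]

end RTrans

/-! ## §3 Reduction ⊣ inclusion, in `K̄ˣ` -/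

section Red

variable (K : Type) [Field K] (p : ℕ) [Fact p.Prime] (k : ℕ)

omit [Fact p.Prime] in
/-- `muVal` of a finite sum is the product of the `muVal`s. [cite: MilneADT2006, I §0] -/
theorem muVal_sum {ι : Type*} (s : Finset ι) (n : ℕ) (f : ι → MuCarrier K n) :
    muVal K n (∑ i ∈ s, f i) = ∏ i ∈ s, muVal K n (f i) := by
  classical
  induction s using Finset.induction_on with
  | empty => rw [Finset.sum_empty, Finset.prod_empty, muVal_zero]
  | insert i s hi ih => rw [Finset.sum_insert hi, Finset.prod_insert hi, muVal_add, ih]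

/-- **Reduction `ζ ↦ ζ^p` is adjoint to the inclusion `a ↦ p·a` for the summed pairings, in `K̄ˣ`**:
`Σ_y B_k(ζ_y^p, a_y)` and `Σ_y B_{k+1}(ζ_y, p·a_y)` have the same underlying unit (termwise `muZModPairing_muPowMap`).
[cite: MilneADT2006, I §4 p. 65] [cite: Kato2004Asterisque, §8.2 (p. 180)] -/
theorem muVal_sum_muZModPairing_muPowMap {ι : Type*} [Fintype ι] (ζ : ι → MuCarrier K (p ^ (k + 1))) (a : ι → ZMod (p ^ k)) :
    muVal K (p ^ k) (∑ y, muZModPairing K p k (muPowMap K (pow_dvd_pow p (Nat.le_succ k)) (ζ y)) (a y)) =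
      muVal K (p ^ (k + 1)) (∑ y, muZModPairing K p (k + 1) (ζ y) (zmodIncl p k (a y))) := by
  rw [muVal_sum, muVal_sum]
  exact Finset.prod_congr rfl fun y _ => muZModPairing_muPowMap K p k (ζ y) (a y)

end Red

end Literature.NumberTheory.ComplexMultiplication.EllipticUnits.JohnsonLeungKings2011.ClassGroupRow

end
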